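import Summits.ABC.IUTFork.Cor312StatementSmallBadMassReal
import HarnessLib

/-!
# [IUTchIII] Cor. 3.12 — the typed Statement at `Real.settingPrVolSharp` under the CONCRETE mass condition
# `3·n_v ≤ [F:ℚ]` at every (lone, odd, unramified) bad place

PROOF-ONLY sequel (abc-iut cell, Cor. 3.12 cone, D-0067; seat abc-iut-w4-d006, gen 4) of `Cor312StatementSmallBadMassReal`
(`statement_settingPrVolSharp_of_lone_badMass_le`: the typed Statement of [IUTchIII] Cor. 3.12 HOLDS at abc-iut-c312-7's
print-normalised sharp real setting for realising pilot ideles when every bad place is a lone bad place over an odd prime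
`p ∤ disc(F)` with `Σ_{j≤ℓ⋇} j²·(n_v/[F:ℚ])^j ≤ ℓ⋇`). TAKES NO SIDE on [IUTchIII] Cor. 3.12; theorems only, 0 `def`s, no
new `Prop` fact. Here the mass condition is made CONCRETE: `j² ≤ 3^j` (`sq_le_three_pow`), so `Pr(v) = n_v/[F:ℚ] ≤ 1/3`
gives `Σ_{j≤r} j²·Pr(v)^j ≤ r` for every `r` (`mass_le_of_weight_le_third`), whence
**`statement_settingPrVolSharp_of_lone_weight_le_third`**: `3·n_v ≤ [F:ℚ]` at every `v ∈ S` (with the lone / odd /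
unramified conditions and realising ideles) ⟹ the typed `Cor312.Setting.Statement` at `Real.settingPrVolSharp`, for ANY
Thm-3.11 context binders and EVERY idele depth — e.g. a bad prime splitting in `F` into places one of which, of local
degree `≤ [F:ℚ]/3`, is the only bad one. HONEST SCOPE as in the parent file (OUR sharp containers and typed (Ind1)/(Ind2);
packets over `2·disc(F)` with a bad place not treated; nothing about the number-level `Cor22.Cor312AtDatum` or abc).
[cite: DupuyHilado2025, §3.3, §3.6] [claim: Mochizuki2012, status: disputed] typed ≠ proved; instantiated ≠ endorsed.
-/

noncomputable section

open Set Function NumberField IsDedekindDomain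
open scoped Pointwise

namespace Summit.ABC

namespace IUTFork

namespace Thm311

namespace Real

open Cor312 Cor312Vol Literature.IUT.LogThetaLattice Literature.IUT.LogVolume

variable {F : Type} [Field F] [NumberField F] (X : PilotData F) {logv : PadicLogs F} (hlog : LogvAnalytic logv)

/-! ## 1. The concrete mass condition -/

/-- `j² ≤ 3^j` for every natural number `j`. [folklore] -/
theorem sq_le_three_pow (j : ℕ) : j ^ 2 ≤ 3 ^ j := by
  induction j with
  | zero => simp
  | succ k ih =>
    rcases Nat.lt_or_ge k 2 with hk | hk
    · interval_cases k <;> norm_num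
    · have h3 : 3 ^ (k + 1) = 3 * 3 ^ k := by ring
      nlinarith [ih, hk]

/-- **A concrete mass condition**: if `3·n_v ≤ [F:ℚ]` (i.e. `Pr(v) ≤ 1/3`) then `Σ_{i<ℓ⋇} (i+1)²·Pr(v)^{i+1} ≤ ℓ⋇`
(each summand is `≤ (i+1)²/3^{i+1} ≤ 1`). [folklore] -/
theorem mass_le_of_weight_le_third {v : HeightOneSpectrum (𝓞 F)} (hv : weight F v ≤ 1 / 3) (r : ℕ) :
    ∑ i : Fin r, (((i : ℕ) : ℝ) + 1) ^ 2 * weight F v ^ ((i : ℕ) + 1) ≤ (r : ℝ) := by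
  have hw0 : 0 ≤ weight F v := weight_nonneg F v
  have hterm : ∀ i : Fin r, (((i : ℕ) : ℝ) + 1) ^ 2 * weight F v ^ ((i : ℕ) + 1) ≤ 1 := by
    intro i
    have h1 : weight F v ^ ((i : ℕ) + 1) ≤ (1 / 3 : ℝ) ^ ((i : ℕ) + 1) := pow_le_pow_left₀ hw0 hv _
    have h2 : ((((i : ℕ) + 1) ^ 2 : ℕ) : ℝ) ≤ ((3 ^ ((i : ℕ) + 1) : ℕ) : ℝ) := by
      exact_mod_cast sq_le_three_pow ((i : ℕ) + 1)
    have h3 : (0 : ℝ) < (3 : ℝ) ^ ((i : ℕ) + 1) := by positivity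
    calc (((i : ℕ) : ℝ) + 1) ^ 2 * weight F v ^ ((i : ℕ) + 1)
        ≤ (((i : ℕ) : ℝ) + 1) ^ 2 * (1 / 3 : ℝ) ^ ((i : ℕ) + 1) :=
          mul_le_mul_of_nonneg_left h1 (by positivity)
      _ = (((i : ℕ) : ℝ) + 1) ^ 2 / (3 : ℝ) ^ ((i : ℕ) + 1) := by rw [one_div, inv_pow, div_eq_mul_inv]
      _ ≤ 1 := by
          rw [div_le_one h3]
          push_cast at h2
          exact h2
  calc ∑ i : Fin r, (((i : ℕ) : ℝ) + 1) ^ 2 * weight F v ^ ((i : ℕ) + 1) ≤ ∑ _i : Fin r, (1 : ℝ) :=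
        Finset.sum_le_sum fun i _ => hterm i
    _ = (r : ℝ) := by simp

/-! ## 2. The typed Statement under `3·n_v ≤ [F:ℚ]` -/

section Sharp

variable (M : Type) [Field M] [NumberField M]
  (archPk : ∀ (j : (thetaIndex X).Label) (vQ : (thetaIndex X).VQ), Set ((logShellsDH X logv).Packet j vQ))
  (archSub : ∀ (j : (thetaIndex X).Label) (v : (thetaIndex X).V),
    Set ((logShellsDH X logv).Packet j ((thetaIndex X).over v)))
  (Ψ : ℤ → ∀ v : (thetaIndex X).V, v ∈ (thetaIndex X).Vbad → Set ((logShellsDH X logv).StarPacket v))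
  (act : ℤ → ∀ v : (thetaIndex X).V, v ∈ (thetaIndex X).Vbad →
    (logShellsDH X logv).StarPacket v → Module.End ℚ ((logShellsDH X logv).StarPacket v))
  (Mmod : ℤ → ∀ j : (thetaIndex X).LabelStar, Set ((logShellsDH X logv).GlobalPacket j.1))
  (region : ℤ → ∀ j : (thetaIndex X).LabelStar, FinDivisor M → ∀ vQ : (thetaIndex X).VQ,
    Set ((logShellsDH X logv).Packet j.1 vQ))
  (n : ℤ) {HT : Type} {LogLink : HT → HT → Type} {IsFull : ∀ {s t : HT}, LogLink s t → Prop}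
  (lat : LGPGaussianLogThetaLattice LogLink IsFull)
  {Frd : Type} {IsoF : Frd → Frd → Type} {Ob : Frd → Type} {realify : Frd → Frd} {Strip : Type}
  {IsoS : Strip → Strip → Type} {Mv : ∀ v : (thetaIndex X).V, v ∈ (thetaIndex X).Vbad → Type}
  [∀ v h, Monoid (Mv v h)]
  (sig : GlobalLGPFrobenioidSignature (thetaIndex X).lstar (thetaIndex X).V (· ∈ (thetaIndex X).Vbad)
    Frd IsoF Ob realify Strip IsoS Mv)
  (split : SplittingMonoids Mv) {ObΔ : Type} {N : ∀ v : (thetaIndex X).V, v ∈ (thetaIndex X).Vbad → Type}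
  [∀ v h, Monoid (N v h)] (qData : QPilotData ObΔ N)
  (t : ∀ (pp : Nat.Primes) (_ : Fin X.lstar) (x : (thetaIndex X).Fibre (.inr pp)),
    haveI : Fact (pp : ℕ).Prime := ⟨pp.2⟩; kOf X pp.1 x)
  (tq : ∀ (pp : Nat.Primes) (x : (thetaIndex X).Fibre (.inr pp)), haveI : Fact (pp : ℕ).Prime := ⟨pp.2⟩; kOf X pp.1 x)
  (ht0 : ∀ pp i x, t pp i x ≠ 0)
  (ht1 : ∀ (pp : Nat.Primes) (i : Fin X.lstar) (x : (thetaIndex X).Fibre (.inr pp)),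
    haveI : Fact (pp : ℕ).Prime := ⟨pp.2⟩; placeOf X pp.1 x ∉ X.S → ‖t pp i x‖ = 1)
  /- the Θ-ideles REALISE `P_Θ` in Dupuy–Hilado's normalisation (3.4) -/
  (ht : ∀ (pp : Nat.Primes) (i : Fin X.lstar) (x : (thetaIndex X).Fibre (.inr pp)),
    haveI : Fact (pp : ℕ).Prime := ⟨pp.2⟩
    Real.log ‖t pp i x‖ = -(X.thetaPilot i (placeOf X pp.1 x)) * logNorm F (placeOf X pp.1 x) /
      localDegree F (placeOf X pp.1 x))
  (htq0 : ∀ pp x, tq pp x ≠ 0)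
  (htq1 : ∀ (pp : Nat.Primes) (x : (thetaIndex X).Fibre (.inr pp)),
    haveI : Fact (pp : ℕ).Prime := ⟨pp.2⟩; placeOf X pp.1 x ∉ X.S → ‖tq pp x‖ = 1)

include ht0 ht1 ht in
/-- **Concrete form: `3·n_v ≤ [F:ℚ]` at every bad place suffices** (with the lone / odd / unramified conditions): e.g. a
bad prime that splits in `F` into at least three places exactly one of which is bad of residue degree and ramification
one. [cite: DupuyHilado2025, §3.3, §3.6] [claim: Mochizuki2012, status: disputed] -/
theorem statement_settingPrVolSharp_of_lone_weight_le_third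
    (htq : ∀ (pp : Nat.Primes) (x : (thetaIndex X).Fibre (.inr pp)),
      haveI : Fact (pp : ℕ).Prime := ⟨pp.2⟩
      Real.log ‖tq pp x‖ = -(X.qPilot (placeOf X pp.1 x)) * logNorm F (placeOf X pp.1 x) /
        localDegree F (placeOf X pp.1 x))
    (hodd : ∀ v ∈ X.S, 2 < residueChar F v)
    (hunr : ∀ v ∈ X.S, ¬ ((residueChar F v : ℕ) : ℤ) ∣ NumberField.discr F)
    (hlone : ∀ v ∈ X.S, ∀ w ∈ X.S, residueChar F w = residueChar F v → w = v)
    (hthird : ∀ v ∈ X.S, 3 * localDegree F v ≤ Module.finrank ℚ F) :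
    (settingPrVolSharp X hlog M archPk archSub Ψ act Mmod region n lat sig split qData tq t htq0 htq1).Statement := by
  refine statement_settingPrVolSharp_of_lone_badMass_le X hlog M archPk archSub Ψ act Mmod region n lat sig split qData t
    tq ht0 ht1 ht htq0 htq1 htq hodd hunr hlone fun v hv => mass_le_of_weight_le_third (F := F) ?_ X.lstar
  have hd : (0 : ℝ) < (Module.finrank ℚ F : ℝ) := by exact_mod_cast Module.finrank_pos
  unfold weight
  rw [div_le_iff₀ hd]
  have := hthird v hv
  have h' : (3 : ℝ) * (localDegree F v : ℝ) ≤ (Module.finrank ℚ F : ℝ) := by exact_mod_cast this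
  linarith


end Sharp

end Real

end Thm311

end IUTFork

end Summit.ABC

end
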